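import Summits.BirchSwinnertonDyer.Rank1Residual.X11b.BDPRouteLocalIndexTransport
import Literature.NumberTheory.EllipticCurves.AnticyclotomicInertiaAboveP
import Literature.NumberTheory.EllipticCurves.KummerSelmerStructure
import Literature.NumberTheory.GaloisRepresentations.AbsGaloisOuterConj
import HarnessLib

/-!
# Crux 4 `BSDpOnCellC` (stmt-BirchSwinnertonDyer-19034), line b1, stub `stub_ctlOrSwitch` — the
# CHAIN-END LEMMA: a curve with NO ℚ-rational étale `p`-line has NO `K`-rational `p`-torsion over
# every imaginary quadratic `K` in which `p` splits (cell `bsd-eis`, seat `bsd-eis-k5-c4` g4;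
# THEOREMS ONLY, `--supports stmt-BirchSwinnertonDyer-19034`)

HONEST FRAMING (cell `bsd-eis`, run/shared/lean/pub/bsd-eis/): theorems only; nothing booked; X2
stays CONSTRUCTION-SHAPED; no label or count moves; closes nothing (a kernel REDUCTION lemma for the
torsion residual of `stub_ctlOrSwitch`, k5-c4-MEMO-2).

## Why this file

The registered stub `stub_ctlOrSwitch` of skeleton b1 v7 asks, at every split X2c pair `(W, p)`, for
the anticyclotomic control theorem `SplitControlOnTree W p` OR an ÉTALE SWITCH: an isogenous globally
minimal `W′` with a Manin datum prime to `p` and `W′(ℚ_p)[p] = 0` (then control is the THEOREM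
`X2.splitControlOnTree_of_cellC_of_noPadicPTorsion`, p434550). The switch is reached by walking the
ℚ-rational étale `p`-isogeny chain out of the `X₀(N)`-optimal curve (cgshw MEMO-11/12: 578/592 window
pairs); its residual (14/543 classes @3 in the window) was booked as «control WITH torsion», cgshw
MEMO-7 §2c (I1)–(I6). This file proves the lemma that SHRINKS that residual: at the END of the étale
chain — a curve `W′` admitting NO `Γ_ℚ`-stable subgroup `Φ ≤ W′[p]` of order `p` fixed pointwise by
the decomposition group `D_p` — one has `W′(K)[p] = 0` for EVERY imaginary quadratic `K` in which
`p` splits. Hence the residual construction is control with LOCAL `p`-torsion (`W′(ℚ_p)[p] ≠ 0`) but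
NO GLOBAL `K`-torsion, under which the control map stays injective
(`AcSelmer.controlMap_injective_of_fixedPoints_eq_bot`) and the base count
`X2.natCard_selmerAcBase_mul_eq_of_rankOne_of_noTorsion` (hypothesis `E(K)[p] = 0` only, local factor
`#E(ℚ_p)[p^∞]` already present) applies verbatim — see k5-c4-MEMO-2 for the atom-by-atom plan.

## What is proved (pure Galois-module algebra on the tree's objects; no named fact)

* `fixedLine_smul_mem`, `fixedLine_fixed_of_le` — for a NORMAL subgroup `H ⊴ Γ_ℚ` the subgroup
  `W[p]^H` of `H`-fixed `p`-torsion points is `Γ_ℚ`-stable, and fixed pointwise by every `D ≤ H`;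
* `natCard_fixedLine_eq_or` — `#W[p]^H ∈ {1, p, p²}` (`#W[p] = p²`, Lagrange);
* `decomp_le_range_of_splitsIn` — for `K` imaginary quadratic with `p` split (`X11b.SplitsIn K p`),
  `D_v ≤ res(Γ_K)` for the place `v ∋ p` of `ℚ` (tree:
  `SorensenPatching.decompositionSubgroup_le_range_of_ncard_primesOver_eq`, Neukirch I (9.3));
* `map_absEmbedding_mem_fixedLine` — a `K`-rational point `Q` with `p • Q = 0` gives the point
  `e(Q) ∈ W[p]^{res(Γ_K)}` (`e = absEmbedding ℚ K`), nonzero iff `Q ≠ 0`;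
* **`exists_etaleLine_of_torsion_ne_zero`** — MAIN: if `D_v` does not fix ALL of `W[p]` (true at
  every odd `p`; at a multiplicative `p` it is the Tate line structure) and `W(K)[p] ≠ 0`, then there
  is a `Γ_ℚ`-stable `Φ ≤ W[p]` of order `p` fixed pointwise by `D_v` — an ÉTALE rational `p`-line
  (the kernel of one more étale step of the chain);
* **`forall_torsion_eq_zero_of_no_etaleLine`** — contrapositive, the CHAIN-END LEMMA:
  no étale rational `p`-line ⟹ `∀ Q ∈ W(K), p • Q = 0 → Q = 0`, for every imaginary quadratic `K`
  with `p` split — exactly the hypothesis `hivK0` of `X2.natCard_selmerAcBase_mul_eq_of_rankOne_of_noTorsion`.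

References: [GreenbergLNM1716] §3 Lemma 3.1 (p. 86); [NeukirchANT1999] Ch. I §9 (9.3);
[DokchitserDokchitser2015LocalInvariants] Thm. A.1, Prop. 4.10 (the étale direction); cgshw MEMO-7
§2c, MEMO-11 §1 (iv), MEMO-12 C2; k5-c4-MEMO-2.
-/

set_option autoImplicit false
-- the route's Theorems namespace `Summit.BirchSwinnertonDyer.BirchSwinnertonDyer.Theorems` (summit = problem) trips the linter
set_option linter.dupNamespace false

noncomputable section

open scoped Classical

open WeierstrassCurve NumberField IsDedekindDomain Field
open Literature.NumberTheory.EllipticCurves Literature.NumberTheory.EllipticCurves.GreenbergSelmer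
  Literature.NumberTheory.GaloisRepresentations
  Summit.BirchSwinnertonDyer.Rank1Residual.X11b

namespace Summit.BirchSwinnertonDyer.BirchSwinnertonDyer.Theorems.EtaleChainEnd

variable (W : WeierstrassCurve ℚ) (p : ℕ) [hp : Fact p.Prime]

/-! ## §1. The `H`-fixed `p`-torsion for a normal subgroup `H ⊴ Γ_ℚ` -/

section FixedLine

variable (H : Subgroup (absoluteGaloisGroup ℚ))

omit hp in
/-- Membership in `W[p]^H = FixedPoints.addSubgroup H W[p]`: fixed by every element of `H`.
[folklore] -/
theorem mem_fixedLine_iff (P : geomTorsion W (p : ℤ)) :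
    P ∈ FixedPoints.addSubgroup H (geomTorsion W (p : ℤ)) ↔ ∀ h ∈ H, h • P = P := by
  rw [FixedPoints.mem_addSubgroup]
  exact ⟨fun hP h hh ↦ hP ⟨h, hh⟩, fun hP h ↦ hP h h.2⟩

omit hp in
/-- **`W[p]^H` is `Γ_ℚ`-stable when `H` is normal** (Greenberg's Lemma 3.1 bookkeeping: `h σ P =
σ (σ⁻¹ h σ) P`). [cite: GreenbergLNM1716, §3 Lemma 3.1 (p. 86)] -/
theorem fixedLine_smul_mem [hN : H.Normal] (σ : absoluteGaloisGroup ℚ) {P : geomTorsion W (p : ℤ)}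
    (hP : P ∈ FixedPoints.addSubgroup H (geomTorsion W (p : ℤ))) :
    σ • P ∈ FixedPoints.addSubgroup H (geomTorsion W (p : ℤ)) := by
  rw [mem_fixedLine_iff] at hP ⊢
  intro h hh
  have hconj : σ⁻¹ * h * σ⁻¹⁻¹ ∈ H := hN.conj_mem h hh σ⁻¹
  rw [inv_inv] at hconj
  have key : h • σ • P = σ • ((σ⁻¹ * h * σ) • P) := by
    rw [smul_smul, smul_smul]
    congr 1
    group
  rw [key, hP _ hconj]

omit hp in
/-- Every subgroup `D ≤ H` fixes `W[p]^H` pointwise. [folklore] -/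
theorem fixedLine_fixed_of_le {D : Subgroup (absoluteGaloisGroup ℚ)} (hDH : D ≤ H)
    {g : absoluteGaloisGroup ℚ} (hg : g ∈ D) {P : geomTorsion W (p : ℤ)}
    (hP : P ∈ FixedPoints.addSubgroup H (geomTorsion W (p : ℤ))) : g • P = P :=
  (mem_fixedLine_iff W p H P).mp hP g (hDH hg)

/-- `#W[p] = p²` for an elliptic curve over `ℚ` (tree `natCard_geomTorsion`).
[cite: SilvermanAEC2009, Cor. III.6.4(b)] -/
theorem natCard_geomTorsion_eq_sq [W.IsElliptic] : Nat.card (geomTorsion W (p : ℤ)) = p ^ 2 := by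
  rw [natCard_geomTorsion (W := W) (n := (p : ℤ)) (by exact_mod_cast hp.out.ne_zero),
    Int.natAbs_natCast]

/-- **`#W[p]^H ∈ {1, p, p²}`** (Lagrange in the group `W[p]` of order `p²`). [folklore] -/
theorem natCard_fixedLine_eq_or [W.IsElliptic] :
    Nat.card (FixedPoints.addSubgroup H (geomTorsion W (p : ℤ))) = 1 ∨
      Nat.card (FixedPoints.addSubgroup H (geomTorsion W (p : ℤ))) = p ∨
        Nat.card (FixedPoints.addSubgroup H (geomTorsion W (p : ℤ))) = p ^ 2 := by
  have hdvd : Nat.card (FixedPoints.addSubgroup H (geomTorsion W (p : ℤ))) ∣ p ^ 2 := by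
    rw [← natCard_geomTorsion_eq_sq W p]
    exact AddSubgroup.card_addSubgroup_dvd_card _
  obtain ⟨i, hi, heq⟩ := (Nat.dvd_prime_pow hp.out).mp hdvd
  interval_cases i
  · left; simpa using heq
  · right; left; simpa using heq
  · right; right; exact heq

/-- If `#W[p]^H = p²` then `H` fixes every point of `W[p]`. [folklore] -/
theorem forall_smul_eq_of_natCard_eq_sq [W.IsElliptic]
    (h : Nat.card (FixedPoints.addSubgroup H (geomTorsion W (p : ℤ))) = p ^ 2) :
    ∀ g ∈ H, ∀ P : geomTorsion W (p : ℤ), g • P = P := by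
  haveI : Finite (geomTorsion W (p : ℤ)) :=
    Nat.finite_of_card_ne_zero (by rw [natCard_geomTorsion_eq_sq W p]; exact pow_ne_zero _ hp.out.ne_zero)
  have htop : FixedPoints.addSubgroup H (geomTorsion W (p : ℤ)) = ⊤ :=
    AddSubgroup.eq_top_of_card_eq _ (by rw [h, natCard_geomTorsion_eq_sq W p])
  intro g hg P
  have hP : P ∈ FixedPoints.addSubgroup H (geomTorsion W (p : ℤ)) := by rw [htop]; trivial
  exact (mem_fixedLine_iff W p H P).mp hP g hg

end FixedLine

/-! ## §2. `p` split in the imaginary quadratic `K`: `D_v ≤ res(Γ_K)`, and `K`-points are fixed -/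

section Split

variable {K : Type} [Field K] [NumberField K]

omit hp in
/-- **At a prime `p` split in the imaginary quadratic field `K`, the decomposition group `D_v ≤ Γ_ℚ`
(`GreenbergSelmer.decomp v`, `v ∋ p` the place of `ℚ`, tree's chosen prime) lies in `res(Γ_K)`**
(Neukirch I (9.3): `Z_𝔓 ⊆ Γ_K` at a completely split prime; tree
`SorensenPatching.decompositionSubgroup_le_range_of_ncard_primesOver_eq` with
`decompositionSubgroup_adicCompletionPrime_eq_range`). The prime `𝔭 ∋ p` of `K` is any of the two.
[cite: NeukirchANT1999, Ch. I §9 (9.3); Ch. II §9 Prop. (9.6)] -/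
theorem decomp_le_range_of_splitsIn [Fact p.Prime] (hK : IsImaginaryQuadratic K) (hs : SplitsIn K p)
    {𝔭 : HeightOneSpectrum (𝓞 K)} (h𝔭 : ((p : ℕ) : 𝓞 K) ∈ 𝔭.asIdeal)
    {v : HeightOneSpectrum (𝓞 ℚ)} (hpv : ((p : ℕ) : 𝓞 ℚ) ∈ v.asIdeal) :
    decomp (K := ℚ) v ≤ (absGaloisRestrict ℚ K).range := by
  haveI : Algebra.IsQuadraticExtension ℚ K := ⟨hK.1⟩
  haveI : IsGalois ℚ K := inferInstance
  -- the conjugate prime and the complete splitting of `(p)` in `K`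
  obtain ⟨-, 𝔮, -, hne, h𝔮, -⟩ := LocalIndexTransport.exists_conj_prime_of_splitsIn K p hK.1 hs h𝔭
  have hsplit : (((𝔭.under (𝓞 ℚ)).asIdeal).primesOver (𝓞 K)).ncard = Module.finrank ℚ K :=
    ZpExtension.ncard_primesOver_under_eq_finrank_of_ne hK.1 h𝔭 h𝔮 hne
  -- `v` is the place of `ℚ` below `𝔭`
  have hv : 𝔭.under (𝓞 ℚ) = v := by
    rw [under_eq_ratPlace_of_mem h𝔭]
    exact ((natCast_mem_asIdeal_iff_eq_primesEquiv_symm v Fact.out).mp hpv).symm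
  rw [hv] at hsplit
  -- `D_v = Z_{𝔓₀}` for the prime `𝔓₀` cut out by `ℚ̄ → \bar ℚ_v`, and `Z_{𝔓₀} ≤ res(Γ_K)`
  intro g hg
  have hg' : g ∈ (adicCompletionPrime ℚ v).decompositionSubgroup (absoluteGaloisGroup ℚ) := by
    rw [decompositionSubgroup_adicCompletionPrime_eq_range]
    exact hg
  exact SorensenPatching.decompositionSubgroup_le_range_of_ncard_primesOver_eq hsplit
    (adicCompletionPrime_mem_primesAbove ℚ v) hg'

omit hp in
/-- For `K/ℚ` Galois, `res(Γ_K) ≤ Γ_ℚ` is a normal subgroup (tree `normal_range_absGaloisRestrict`).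
[folklore] -/
theorem normal_range_of_isImaginaryQuadratic (hK : IsImaginaryQuadratic K) :
    ((absGaloisRestrict ℚ K).range).Normal := by
  haveI : Algebra.IsQuadraticExtension ℚ K := ⟨hK.1⟩
  haveI : IsGalois ℚ K := inferInstance
  exact normal_range_absGaloisRestrict ℚ K

/-- The geometric point `e(Q) ∈ W(ℚ̄)` of a `K`-rational point `Q`, along the tree's embedding
`e = absEmbedding ℚ K : K → ℚ̄`. [folklore] -/
theorem map_absEmbedding_smul_eq_of_mem_range {g : absoluteGaloisGroup ℚ}
    (hg : g ∈ (absGaloisRestrict ℚ K).range) (Q : (W.baseChange K).toAffine.Point) :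
    g • (show W.geomPoints from Affine.Point.map (W' := W) (absEmbedding ℚ K) Q) =
      (show W.geomPoints from Affine.Point.map (W' := W) (absEmbedding ℚ K) Q) := by
  have hfix := (mem_range_absGaloisRestrict_iff_smul_absEmbedding ℚ K g).mp hg
  have hcomp : (absoluteGaloisGroup.toAlgEquiv ℚ g).toAlgHom.comp (absEmbedding ℚ K) =
      absEmbedding ℚ K := by
    ext x
    exact hfix x
  change Affine.Point.map (W' := W) (absoluteGaloisGroup.toAlgEquiv ℚ g).toAlgHom
      (Affine.Point.map (W' := W) (absEmbedding ℚ K) Q) = _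
  rw [Affine.Point.map_map, hcomp]

omit hp in
/-- **A nonzero `K`-rational `p`-torsion point gives a nonzero point of `W[p]^{res(Γ_K)}`**: the
geometric point `e(Q)` (`e = absEmbedding ℚ K`) is killed by `p`, fixed by `res(Γ_K)`
(`mem_range_absGaloisRestrict_iff_smul_absEmbedding`), and nonzero (`Affine.Point.map_injective`).
[cite: SilvermanAEC2009, VIII.§1 (proof of Prop. 1.2)] -/
theorem exists_mem_fixedLine_ne_zero_of_torsion {Q : (W.baseChange K).toAffine.Point}
    (hQ : p • Q = 0) (hQ0 : Q ≠ 0) :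
    ∃ P : geomTorsion W (p : ℤ),
      P ∈ FixedPoints.addSubgroup ((absGaloisRestrict ℚ K).range) (geomTorsion W (p : ℤ)) ∧ P ≠ 0 := by
  set P₀ : W.geomPoints := (show W.geomPoints from Affine.Point.map (W' := W) (absEmbedding ℚ K) Q)
    with hP₀
  have hP₀p : p • P₀ = 0 := by
    rw [hP₀]
    change p • Affine.Point.map (W' := W) (absEmbedding ℚ K) Q = 0
    rw [← map_nsmul, hQ, map_zero]
  have hP₀ne : P₀ ≠ 0 := by
    intro h0
    apply hQ0
    apply Affine.Point.map_injective (W' := W) (f := absEmbedding ℚ K)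
    rw [map_zero]
    exact h0
  refine ⟨⟨P₀, AddSubgroup.torsionBy.nsmul_iff.mpr hP₀p⟩, ?_, ?_⟩
  · rw [mem_fixedLine_iff]
    intro g hg
    apply Subtype.ext
    rw [AddSubgroup.torsionBy.coe_smul]
    exact map_absEmbedding_smul_eq_of_mem_range W hg Q
  · intro h0
    exact hP₀ne (congrArg Subtype.val h0)

/-- **MAIN — an ÉTALE rational `p`-line from a `K`-rational `p`-torsion point.** Let `K` be imaginary
quadratic with `p` split (`SplitsIn K p`), `𝔭 ∋ p` a prime of `K`, `v ∋ p` the place of `ℚ`, and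
suppose `D_v` does NOT fix all of `W[p]` (`hD`; automatic at every odd `p`, since `μ_p ⊄ ℚ_p` and the
Weil pairing — supplied by the consumer, e.g. from the Tate line at a multiplicative `p`). If `W` has a
NONZERO `K`-rational point `Q` with `p • Q = 0`, then there is a `Γ_ℚ`-STABLE subgroup `Φ ≤ W[p]` of
order `p` FIXED POINTWISE by `D_v`: the line `W[p]^{res(Γ_K)}` (`res(Γ_K) ⊴ Γ_ℚ` as `K/ℚ` is Galois;
`D_v ≤ res(Γ_K)` as `p` splits; order `p` and not `p²` by `hD`). Such a `Φ` is the kernel of a further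
ÉTALE `p`-isogeny step (Silverman III.4.12 over `ℚ`; Dokchitser–Dokchitser 2015 Thm. A.1 / Prop. 4.10:
`v_p(j(W)) = p·v_p(j(W/Φ))`, the Manin constant is preserved — the tree's
`X2.dokchitserStevens_maninDatum_of_pIsogeny`). [cite: GreenbergLNM1716, §3 Lemma 3.1 (p. 86)]
[cite: NeukirchANT1999, Ch. I §9 (9.3)] [cite: DokchitserDokchitser2015LocalInvariants, Thm. A.1 (p. 4354) and Prop. 4.10 (p. 4348)] -/
theorem exists_etaleLine_of_torsion_ne_zero [W.IsElliptic] (hK : IsImaginaryQuadratic K)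
    (hs : SplitsIn K p) {𝔭 : HeightOneSpectrum (𝓞 K)} (h𝔭 : ((p : ℕ) : 𝓞 K) ∈ 𝔭.asIdeal)
    {v : HeightOneSpectrum (𝓞 ℚ)} (hpv : ((p : ℕ) : 𝓞 ℚ) ∈ v.asIdeal)
    (hD : ¬ ∀ g ∈ decomp (K := ℚ) v, ∀ P : geomTorsion W (p : ℤ), g • P = P)
    {Q : (W.baseChange K).toAffine.Point} (hQ : p • Q = 0) (hQ0 : Q ≠ 0) :
    ∃ Φ : AddSubgroup (geomTorsion W (p : ℤ)), Nat.card Φ = p ∧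
      (∀ σ : absoluteGaloisGroup ℚ, ∀ P ∈ Φ, σ • P ∈ Φ) ∧
        (∀ g ∈ decomp (K := ℚ) v, ∀ P ∈ Φ, g • P = P) := by
  set H : Subgroup (absoluteGaloisGroup ℚ) := (absGaloisRestrict ℚ K).range with hH
  haveI : H.Normal := normal_range_of_isImaginaryQuadratic hK
  have hDH : decomp (K := ℚ) v ≤ H := decomp_le_range_of_splitsIn p hK hs h𝔭 hpv
  refine ⟨FixedPoints.addSubgroup H (geomTorsion W (p : ℤ)), ?_,
    fun σ P hP ↦ fixedLine_smul_mem W p H σ hP,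
    fun g hg P hP ↦ fixedLine_fixed_of_le W p H hDH hg hP⟩
  -- the order is `p`: not `1` (a nonzero `K`-point), not `p²` (`hD`)
  obtain ⟨P, hP, hP0⟩ := exists_mem_fixedLine_ne_zero_of_torsion W p hQ hQ0
  rcases natCard_fixedLine_eq_or W p H with h1 | hp1 | h2
  · exfalso
    haveI : Finite (FixedPoints.addSubgroup H (geomTorsion W (p : ℤ))) :=
      Nat.finite_of_card_ne_zero (by rw [h1]; exact one_ne_zero)
    have hbot : FixedPoints.addSubgroup H (geomTorsion W (p : ℤ)) = ⊥ :=
      AddSubgroup.eq_bot_of_card_eq _ h1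
    rw [hbot, AddSubgroup.mem_bot] at hP
    exact hP0 hP
  · exact hp1
  · exfalso
    exact hD fun g hg P ↦ forall_smul_eq_of_natCard_eq_sq W p H h2 g (hDH hg) P

/-- **CHAIN-END LEMMA (contrapositive of `exists_etaleLine_of_torsion_ne_zero`).** If `W/ℚ` admits
NO `Γ_ℚ`-stable subgroup `Φ ≤ W[p]` of order `p` fixed pointwise by `D_v` (the END of the ℚ-rational
étale `p`-isogeny chain) and `D_v` does not fix all of `W[p]`, then for EVERY imaginary quadratic `K`
in which `p` splits, `W` has no nonzero `K`-rational point killed by `p`: `E(K)[p] = 0` — exactly the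
hypothesis `hivK0` of `X2.natCard_selmerAcBase_mul_eq_of_rankOne_of_noTorsion` and of the
injectivity half of the anticyclotomic control theorem. So the torsion residual of `stub_ctlOrSwitch`
(cgshw MEMO-11 §1 (iv): classes with no étale switch) needs control with LOCAL `p`-torsion only
(k5-c4-MEMO-2). [cite: GreenbergLNM1716, §3 Lemma 3.1 (p. 86)] [cite: NeukirchANT1999, Ch. I §9 (9.3)] -/
theorem forall_torsion_eq_zero_of_no_etaleLine [W.IsElliptic] (hK : IsImaginaryQuadratic K)
    (hs : SplitsIn K p) {𝔭 : HeightOneSpectrum (𝓞 K)} (h𝔭 : ((p : ℕ) : 𝓞 K) ∈ 𝔭.asIdeal)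
    {v : HeightOneSpectrum (𝓞 ℚ)} (hpv : ((p : ℕ) : 𝓞 ℚ) ∈ v.asIdeal)
    (hD : ¬ ∀ g ∈ decomp (K := ℚ) v, ∀ P : geomTorsion W (p : ℤ), g • P = P)
    (hno : ¬ ∃ Φ : AddSubgroup (geomTorsion W (p : ℤ)), Nat.card Φ = p ∧
      (∀ σ : absoluteGaloisGroup ℚ, ∀ P ∈ Φ, σ • P ∈ Φ) ∧
        (∀ g ∈ decomp (K := ℚ) v, ∀ P ∈ Φ, g • P = P)) :
    ∀ Q : (W.baseChange K).toAffine.Point, p • Q = 0 → Q = 0 := by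
  intro Q hQ
  by_contra hQ0
  exact hno (exists_etaleLine_of_torsion_ne_zero W p hK hs h𝔭 hpv hD hQ hQ0)

/-- The same at EVERY prime `𝔭 ∣ p` of `K`-free form: `SplitsIn K p` alone (a prime above `p`
exists). [folklore] -/
theorem forall_torsion_eq_zero_of_no_etaleLine' [W.IsElliptic] (hK : IsImaginaryQuadratic K)
    (hs : SplitsIn K p) {v : HeightOneSpectrum (𝓞 ℚ)} (hpv : ((p : ℕ) : 𝓞 ℚ) ∈ v.asIdeal)
    (hD : ¬ ∀ g ∈ decomp (K := ℚ) v, ∀ P : geomTorsion W (p : ℤ), g • P = P)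
    (hno : ¬ ∃ Φ : AddSubgroup (geomTorsion W (p : ℤ)), Nat.card Φ = p ∧
      (∀ σ : absoluteGaloisGroup ℚ, ∀ P ∈ Φ, σ • P ∈ Φ) ∧
        (∀ g ∈ decomp (K := ℚ) v, ∀ P ∈ Φ, g • P = P)) :
    ∀ Q : (W.baseChange K).toAffine.Point, p • Q = 0 → Q = 0 := by
  -- a prime of `K` above `p` exists since two do
  have hne : ((Ideal.span {(p : ℤ)}).primesOver (𝓞 K)).Nonempty := by
    apply Set.nonempty_of_ncard_ne_zero
    rw [show ((Ideal.span {(p : ℤ)}).primesOver (𝓞 K)).ncard = 2 from hs]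
    exact two_ne_zero
  obtain ⟨P, hPp, hPover⟩ := hne
  haveI := hPp
  haveI := hPover
  have hPne : P ≠ ⊥ := by
    intro hbot
    have h1 : (Ideal.span {(p : ℤ)} : Ideal ℤ) = ⊥ := by
      have := hPover.over
      rw [hbot, Ideal.under_def, Ideal.comap_bot_of_injective _
        (algebraMap ℤ (𝓞 K)).injective_int] at this
      exact this
    rw [Ideal.span_singleton_eq_bot] at h1
    exact (Fact.out : p.Prime).ne_zero (by exact_mod_cast h1)
  set 𝔭 : HeightOneSpectrum (𝓞 K) := ⟨P, hPp, hPne⟩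
  have h𝔭 : ((p : ℕ) : 𝓞 K) ∈ 𝔭.asIdeal := by
    have hmem : (algebraMap ℤ (𝓞 K)) (p : ℤ) ∈ P := by
      rw [← Ideal.mem_comap]
      have := hPover.over
      rw [Ideal.under_def] at this
      rw [← this]
      exact Ideal.mem_span_singleton_self _
    simpa using hmem
  exact forall_torsion_eq_zero_of_no_etaleLine W p hK hs h𝔭 hpv hD hno

end Split

end Summit.BirchSwinnertonDyer.BirchSwinnertonDyer.Theorems.EtaleChainEnd

end
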